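import Summits.HodgeConjecture.HodgeCM.Model.AdelicThetaComponents_1

/-! PORT of `HodgeCM/Model/AdelicThetaComponents.lean` (HodgeCMPerL run 82) — part 2: continuation of `Summits.HodgeConjecture.HodgeCM.Model.AdelicThetaComponents_1` (split at a top-level declaration boundary by port_pkg.py; scope re-opened below; declarations unchanged). -/

-- port_pkg: scope re-opened for this part (file-level context, then the namespace/section stack open at the cut)
set_option autoImplicit false
noncomputable section
open MulAction NumberField
open Literature.NumberTheory.Automorphic Literature.NumberTheory.Weil1964
open Literature.NumberTheory.Automorphic.WeightForms (restrictHom thetaClasses IsLevelCorrected IsWeightMatched)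
open Literature.Geometry.ComplexHyperbolic.BallModel (U21 x₀)
open Literature.AlgebraicGeometry.HodgeTheory Literature.AlgebraicGeometry.ShimuraVarieties
open Literature.NumberTheory.Automorphic.PicardCM
open Literature.NumberTheory.Automorphic.LevelOrbit (conjLevel mem_conjLevel_iff)
open HodgeCM.Model.SupplyResidual HodgeCM.Model.ThetaSpace
namespace HodgeCM
namespace Model
section Rational
variable {L : CMField} {ι₁ : L →+* ℂ} (V : HermSpace3 L ι₁)
/-- **Splitting of a rational point in the regime model**: for `g ∈ U(V)(L⁺)` there is `a ∈ G_U(𝔸)` lying in EVERY saturation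
subgroup `satLevelRegimeOf V hV K`, commuting with the archimedean component `archInfOf V` and with the finite factor `finToG V hV`, such
that `archInfOf V (toBall g) · a · finToG V hV (g)_f` is the rational point `g` of the model (`∈ Γ_U`). -/
theorem exists_archInfOf_mul_mul_finToG_mem_Γ (hV : IsAnisotropic L V.Hm)
    (g : ↥(unitaryGroup (IsCMField.complexConj L : L →+* L) V.Hm)) :
    ∃ a : (V.latticeModel printFact_unitaryCompact_holds).G,
      (∀ K : Subgroup V.adelicFin, a ∈ satLevelRegimeOf V hV K) ∧
      (∀ y : U21, Commute a (archInfOf V y)) ∧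
      (∀ kf : V.adelicFin, Commute a (finToG V hV kf)) ∧
      archInfOf V (BallRational.toBall L ι₁ V.Hm V.sylvesterFrame (sylvesterFrame_J V) g) * a *
          finToG V hV (UnitaryGroup.rationalToFinAdelic (↥(maximalRealSubfield L)) (L : Type) (IsCMField.complexConj L) 3 V.Hm
            (UnitaryGroup.ballRational (L : Type) V.Hm g)) ∈
        (V.latticeModel printFact_unitaryCompact_holds).Γ := by
  obtain ⟨a₀, ha₀, hfin, hdec⟩ := exists_toAdelic_eq_archSec_mul_mul_finAdelicToAdelic V g
  have ha₀' : a₀ ∈ UnitaryGroup.awayFromCM 3 (L : Type) ι₁ V.Hm := ha₀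
  refine ⟨toLatticeModelG V a₀, fun K => ?_, fun y => ?_, fun kf => ?_, ?_⟩
  · refine toLatticeModelG_mem_satLevelRegimeOf V hV K ?_
    rw [← awayLevelCM_eq_satLevelOf]
    exact (UnitaryGroup.mem_awayLevelCM_iff _ _ _ _ _ _).2 ⟨ha₀', by rw [hfin]; exact one_mem _⟩
  · exact commute_archFinOf_archInfOf V y _ ((mem_archFinOf_iff V _).2 ⟨a₀, ha₀', rfl⟩)
  · -- `a₀` is archimedean (finite component `1`), `finToG kf` is finite: the two factors commute
    have e : UnitaryGroup.archToAdelic (↥(maximalRealSubfield L)) (L : Type) (IsCMField.complexConj L) 3 V.Hm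
        (UnitaryGroup.archPart (↥(maximalRealSubfield L)) (L : Type) (IsCMField.complexConj L) 3 V.Hm a₀) = a₀ := by
      have := UnitaryGroup.archToAdelic_mul_finAdelicToAdelic (↥(maximalRealSubfield L)) (L : Type)
        (IsCMField.complexConj L) 3 V.Hm a₀
      rwa [hfin, map_one, mul_one] at this
    rw [finToG_eq_toLatticeModelG, ← e]
    exact (UnitaryGroup.commute_archToAdelic_finAdelicToAdelic (↥(maximalRealSubfield L)) (L : Type)
      (IsCMField.complexConj L) 3 V.Hm _ kf).map (toLatticeModelG V)
  · have key := toLatticeModelG_mem_Γ V (UnitaryGroup.toAdelic_ballRational_mem_adelicUnitaryRat (L : Type) V.Hm g)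
    rw [archInfOf_eq_toLatticeModelG_archSec, finToG_eq_toLatticeModelG, ← map_mul, ← map_mul]
    convert key using 2
    apply Subtype.ext
    exact congrArg Subtype.val hdec.symm

namespace ThetaAdelicSide

variable {V} {c : SeesawCtx L} (S : ThetaAdelicSide V c)
variable {K₁ W : Type} [Group K₁] [AddCommGroup W] [Module ℂ W] [Module.IsReflexive ℂ W] {κ₁ : K₁ →* U21}
  {τ₁ : Representation ℂ K₁ W}
  {𝓕 : Set C(NumberField.relNormOneIdeles (↥(maximalRealSubfield L)) L ⧸ NumberField.relNormOneRat (↥(maximalRealSubfield L)) L, ℂ)}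

/-- **The components at related indices differ by a left translate**, abstract splitting data: if `S.ιinf γt · a · e_{γf}` is a
rational point of the model with `a ∈ sat(K)` commuting with `S.ιinf` and with the finite factor, then for `F` saturated at
`sat(K)`, `k ∈ K`, every `h`: `compAt F (γf h k) (γt x) = compAt F h x`. -/
theorem compAt_mul_of_split (hV : IsAnisotropic L V.Hm) {k : Fin 4} {Γ : Level V}
    {F : (V.latticeModel printFact_unitaryCompact_holds).G → W}
    (hF : F ∈ adelicThetaSpanSat (S.P k) S.ιinf κ₁ τ₁ (satLevelRegimeOf V hV Γ.K) 𝓕)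
    {γt : U21} {γf : V.adelicFin} {a : (V.latticeModel printFact_unitaryCompact_holds).G}
    (ha : a ∈ satLevelRegimeOf V hV Γ.K) (hcι : ∀ y : U21, Commute a (S.ιinf y))
    (hce : ∀ kf : V.adelicFin, Commute a (finToG V hV kf))
    (hmem : S.ιinf γt * a * finToG V hV γf ∈ (V.latticeModel printFact_unitaryCompact_holds).Γ)
    (h : V.adelicFin) {kK : V.adelicFin} (hk : kK ∈ Γ.K) (x : U21) :
    S.compAt hV F (γf * h * kK) (γt * x) = S.compAt hV F h x := by
  have hleft := left_inv_of_mem_adelicThetaSpan (adelicThetaSpanSat_le_adelicThetaSpan hF)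
  have hΓU : S.ιinf γt * a * finToG V hV γf ∈ (S.P k).ΓU := by rw [S.hΓU k]; exact hmem
  have hcx : Commute (finToG V hV γf) (S.ιinf x) := S.commute_finToG_ιinf hV γf x
  have hca : Commute a (finToG V hV γf) := hce γf
  have hcax : Commute a (S.ιinf x * finToG V hV h) := (hcι x).mul_right (hce h)
  have hsat : a⁻¹ * finToG V hV kK ∈ satLevelRegimeOf V hV Γ.K :=
    Subgroup.mul_mem _ (Subgroup.inv_mem _ ha) (finToG_mem_satLevelRegimeOf V hV hk)
  have e1 : S.ιinf γt * S.ιinf x * (finToG V hV γf * finToG V hV h * finToG V hV kK) =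
      (S.ιinf γt * a * finToG V hV γf) * (a⁻¹ * (S.ιinf x * finToG V hV h) * finToG V hV kK) := by
    calc S.ιinf γt * S.ιinf x * (finToG V hV γf * finToG V hV h * finToG V hV kK)
        = S.ιinf γt * (S.ιinf x * finToG V hV γf) * finToG V hV h * finToG V hV kK := by group
      _ = S.ιinf γt * (finToG V hV γf * S.ιinf x) * finToG V hV h * finToG V hV kK := by rw [hcx.eq]
      _ = S.ιinf γt * (a * a⁻¹ * finToG V hV γf) * S.ιinf x * finToG V hV h * finToG V hV kK := by group
      _ = S.ιinf γt * (a * (finToG V hV γf * a⁻¹)) * S.ιinf x * finToG V hV h * finToG V hV kK := by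
            rw [mul_assoc a, hca.inv_left.eq]
      _ = (S.ιinf γt * a * finToG V hV γf) * (a⁻¹ * (S.ιinf x * finToG V hV h) * finToG V hV kK) := by group
  have e2 : a⁻¹ * (S.ιinf x * finToG V hV h) * finToG V hV kK = S.ιinf x * finToG V hV h * (a⁻¹ * finToG V hV kK) := by
    rw [hcax.inv_left.eq]; group
  calc S.compAt hV F (γf * h * kK) (γt * x)
      = F (S.ιinf γt * S.ιinf x * (finToG V hV γf * finToG V hV h * finToG V hV kK)) := by
          show F (S.ιinf (γt * x) * finToG V hV (γf * h * kK)) = _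
          rw [map_mul, map_mul, map_mul]
    _ = F ((S.ιinf γt * a * finToG V hV γf) * (a⁻¹ * (S.ιinf x * finToG V hV h) * finToG V hV kK)) := by rw [e1]
    _ = F (a⁻¹ * (S.ιinf x * finToG V hV h) * finToG V hV kK) := hleft _ hΓU _
    _ = F (S.ιinf x * finToG V hV h * (a⁻¹ * finToG V hV kK)) := by rw [e2]
    _ = F (S.ιinf x * finToG V hV h) := apply_mul_eq_self_of_mem_adelicThetaSpanSat hF hsat _
    _ = S.compAt hV F h x := rfl

/-- **The components at related indices differ by the rational translate** (the function identity under binder-1's relation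
`Rel Γ γ h h'`, `h' = (γ)_f h k`): for an adelic side whose archimedean component is the honest `archInfOf V` (the S of record) and
`F` saturated at `satLevelRegimeOf V hV Γ.K`: `compAt F ((γ)_f h k) (γ̃ x) = compAt F h x`, `γ̃ = toBall γ ∈ U(2,1)`, `k ∈ Γ.K` —
the hypothesis `hΘ` of binder-1's `pull_mem_thetaClasses_of_apply_eq` (#R104) for the pair of components. -/
theorem compAt_rationalToFinAdelic_mul (hι : S.ιinf = archInfOf V) (hV : IsAnisotropic L V.Hm) {k : Fin 4} {Γ : Level V}
    {F : (V.latticeModel printFact_unitaryCompact_holds).G → W}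
    (hF : F ∈ adelicThetaSpanSat (S.P k) S.ιinf κ₁ τ₁ (satLevelRegimeOf V hV Γ.K) 𝓕)
    (g : ↥(unitaryGroup (IsCMField.complexConj L : L →+* L) V.Hm)) (h : V.adelicFin) {kK : V.adelicFin} (hk : kK ∈ Γ.K)
    (x : U21) :
    S.compAt hV F
        (UnitaryGroup.rationalToFinAdelic (↥(maximalRealSubfield L)) (L : Type) (IsCMField.complexConj L) 3 V.Hm
            (UnitaryGroup.ballRational (L : Type) V.Hm g) * h * kK)
        (BallRational.toBall L ι₁ V.Hm V.sylvesterFrame (sylvesterFrame_J V) g * x) =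
      S.compAt hV F h x := by
  obtain ⟨a, hasat, hcι, hce, hmem⟩ := exists_archInfOf_mul_mul_finToG_mem_Γ V hV g
  refine S.compAt_mul_of_split hV hF (hasat Γ.K) (fun y => ?_) hce ?_ h hk x
  · rw [hι]; exact hcι y
  · rw [hι]; exact hmem

end ThetaAdelicSide

end Rational

end Model
end HodgeCM

end
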